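import Literature.MathematicalPhysics.QuantumLattice.DWaveSourceProofs
import Literature.MathematicalPhysics.QuantumLattice.FinDimSpectrumProofs
import Literature.MathematicalPhysics.QuantumLattice.HubbardModelParticleHoleProofs
import Literature.MathematicalPhysics.QuantumLattice.SectorSpectrum
import HarnessLib

/-!
# Crux `CwSsbToEvenTorusLRO` (stmt-HubbardSuperconductivity-10439, route `ChiralWindow`), line
`griffiths-block-slope` — stub `stub_sectorFloorGC` (grand-canonical floor under a sector energy)

With `H = hubbardTorus 2 L 1 U`, `K_μ = hubbardTorusWith 2 L 1 U μ = H - μ N̂` (`hubbardTorusWith_eq`,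
definitional) and the Kac block operator `W_R = R⁻⁴ Σ_a B_aᴴ B_a`,
`B_a = Σ_{u ∈ [0,R)²} P_{a+u}` (`P_x = localPair dWaveFormFactor L x`), the stub asserts, for every finite
`L`, every `R`, all real `U, μ, κ` and every `N` whose joint sector `(N, S^z = 0)` is nonzero,

`E₀(K_μ + κ W_R) ≤ minEnergyOn (H + κ W_R) (szSector N 0) - μ N`.

Proof (finite-dimensional linear algebra): the Rayleigh set of `H + κ W_R` on the sector is nonempty
(normalise the given nonzero sector vector, `exists_smul_unit`), and for every unit `ψ` of the sector
the variational principle `E₀(A) ≤ re ⟨ψ, A ψ⟩` for the Hermitian `A = K_μ + κ W_R`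
(`groundEnergy_le_rayleigh_holds`) combines with `N̂ ψ = N ψ` (`totalNumber_mulVec_of_isNParticle`),
i.e. `⟨ψ, A ψ⟩ = ⟨ψ, (H + κ W_R) ψ⟩ - μ N`; conclude with `le_csInf`.

No definition is introduced; the helper lemma is private. [folklore]
-/

noncomputable section

set_option linter.dupNamespace false

namespace Summit.HubbardSuperconductivity.HubbardSuperconductivity.Theorems.CwSsbToEvenTorusLRO

open Literature.MathematicalPhysics.QuantumLattice Matrix
open scoped Matrix ComplexOrder Matrix.Norms.L2Operator

-- adapted from `isHermitian_blockRepulsion` (private) of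
-- `Theorems/ChiralWindowCwSsbToEvenTorusLROBlockSlope.lean`
/-- The Kac block operator `W_R = R⁻⁴ Σ_a B_aᴴ B_a` is Hermitian (a real multiple of a sum of
`XᴴX`'s). [folklore] -/
private theorem isHermitian_kacBlockRepulsion' (L : ℕ) [NeZero L] (R : ℕ) :
    ((((((R : ℝ) ^ 4)⁻¹ : ℝ) : ℂ) • ∑ a : Literature.Probability.LatticeModels.TorusSite 2 L, (∑ u : Fin 2 → Fin R, localPair dWaveFormFactor L (a + fun i => ((u i : ℕ) : ZMod L)))ᴴ * (∑ u : Fin 2 → Fin R, localPair dWaveFormFactor L (a + fun i => ((u i : ℕ) : ZMod L))))).IsHermitian := by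
  refine IsHermitian.smul ?_ ?_
  · exact (isSelfAdjoint_sum _ fun a _ =>
      (isHermitian_conjTranspose_mul_self _).isSelfAdjoint).isHermitian
  · rw [isSelfAdjoint_iff, Complex.star_def, Complex.conj_ofReal]

/-- **Stub — grand-canonical floor under the block-repelled sector energy (finite `L`).**
For every `L`, `R`, all real `U, μ, κ` and every `N` with a nonzero joint sector `(N, S^z = 0)`,
`E₀(K_μ + κ W_R) ≤ minEnergyOn (H + κ W_R) (szSector N 0) - μ N`: every unit vector `ψ` of the sector
is a trial vector for the Hermitian `K_μ + κ W_R = (H + κ W_R) - μ N̂`, and `N̂ ψ = N ψ` there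
(variational principle, Tasaki (2020) §2.1, (2.1.6); Lieb, PRL 62 (1989) 1201, §2). [folklore] -/
theorem stub_sectorFloorGC :
    ∀ (L : ℕ) [NeZero L] (R : ℕ) (U μ κ : ℝ) (N : ℕ),
      (∃ φ : Fock (Orb (FermionTorus 2 L)), φ ∈ szSector N 0 ∧ φ ≠ 0) →
        (hubbardTorusWith 2 L 1 U μ + (κ : ℂ) • (((((R : ℝ) ^ 4)⁻¹ : ℝ) : ℂ) • ∑ a : Literature.Probability.LatticeModels.TorusSite 2 L, (∑ u : Fin 2 → Fin R, localPair dWaveFormFactor L (a + fun i => ((u i : ℕ) : ZMod L)))ᴴ * (∑ u : Fin 2 → Fin R, localPair dWaveFormFactor L (a + fun i => ((u i : ℕ) : ZMod L))))).groundEnergy ≤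
          (hubbardTorus 2 L 1 U + (κ : ℂ) • (((((R : ℝ) ^ 4)⁻¹ : ℝ) : ℂ) • ∑ a : Literature.Probability.LatticeModels.TorusSite 2 L, (∑ u : Fin 2 → Fin R, localPair dWaveFormFactor L (a + fun i => ((u i : ℕ) : ZMod L)))ᴴ * (∑ u : Fin 2 → Fin R, localPair dWaveFormFactor L (a + fun i => ((u i : ℕ) : ZMod L))))).minEnergyOn (szSector N 0) - μ * (N : ℝ) := by
  intro L _ R U μ κ N hex
  obtain ⟨φ, hφK, hφ0⟩ := hex
  set W := (((((R : ℝ) ^ 4)⁻¹ : ℝ) : ℂ) • ∑ a : Literature.Probability.LatticeModels.TorusSite 2 L, (∑ u : Fin 2 → Fin R, localPair dWaveFormFactor L (a + fun i => ((u i : ℕ) : ZMod L)))ᴴ * (∑ u : Fin 2 → Fin R, localPair dWaveFormFactor L (a + fun i => ((u i : ℕ) : ZMod L))))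
  have hWh : W.IsHermitian := isHermitian_kacBlockRepulsion' L R
  have hA : (hubbardTorusWith 2 L 1 U μ + (κ : ℂ) • W).IsHermitian := by
    refine (isHermitian_hubbardTorusWith L 1 U μ).add (IsHermitian.smul hWh ?_)
    rw [isSelfAdjoint_iff, Complex.star_def, Complex.conj_ofReal]
  -- the Rayleigh set of `H + κ W` on the sector is nonempty
  obtain ⟨c, -, hc1⟩ := exists_smul_unit hφ0
  have hne : {E : ℝ | ∃ ψ ∈ szSector N 0, star ψ ⬝ᵥ ψ = 1 ∧
      E = (star ψ ⬝ᵥ (hubbardTorus 2 L 1 U + (κ : ℂ) • W) *ᵥ ψ).re}.Nonempty :=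
    ⟨_, c • φ, Submodule.smul_mem _ c hφK, hc1, rfl⟩
  rw [le_sub_iff_add_le]
  unfold Matrix.minEnergyOn
  refine le_csInf hne ?_
  rintro E ⟨ψ, hψK, hψ1, rfl⟩
  have hψN : IsNParticle N ψ := ((mem_szSector_iff N 0 ψ).1 hψK).1
  have h1 := groundEnergy_le_rayleigh_holds hA ψ hψ1
  have e : (hubbardTorusWith 2 L 1 U μ + (κ : ℂ) • W) *ᵥ ψ =
      (hubbardTorus 2 L 1 U + (κ : ℂ) • W) *ᵥ ψ - (μ : ℂ) • ((N : ℂ) • ψ) := by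
    rw [hubbardTorusWith_eq, sub_add_eq_add_sub, sub_mulVec, smul_mulVec,
      totalNumber_mulVec_of_isNParticle hψN]
  rw [e, dotProduct_sub, dotProduct_smul, dotProduct_smul, hψ1, smul_eq_mul, smul_eq_mul,
    mul_one] at h1
  simp only [Complex.sub_re, Complex.mul_re, Complex.ofReal_re, Complex.natCast_re,
    Complex.ofReal_im, Complex.natCast_im, mul_zero, sub_zero] at h1
  linarith

end Summit.HubbardSuperconductivity.HubbardSuperconductivity.Theorems.CwSsbToEvenTorusLRO

end
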